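import Literature.Geometry.Riemannian.MetricWedgeFamily
import Literature.Geometry.Riemannian.GromovW1Triangle
import Mathlib.Topology.MetricSpace.Gluing
import HarnessLib

/-!
# Gluing a chain of metric spaces along changing hubs, and `d_{W₁}` of push-forwards under
# re-embeddings (Bamler 2023, §5.2 Lemma 5.15, §5.4 proof of Thm. 5.19)

R. Bamler, *Compactness theory of the space of super Ricci flows*, Invent. Math. 233 (2023), §5.4,
proof of Theorem 5.19 (arXiv v1 Thm. 120, completeness of `(𝔽^J_I, d^J_𝔽)`): *"By an iterative
application of Lemma 5.15 [arXiv v1 Lemma 114, combining correspondences], we can construct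
sequences of correspondences `ℭ^{1…k}` between `𝒳¹, …, 𝒳ᵏ` such that for any `1 ≤ i < k`
`d_𝔽^{ℭ^{1…k},J}(𝒳^i, 𝒳^{i+1}) = d_𝔽^{ℭ^{i,i+1},J}(𝒳^i, 𝒳^{i+1})`. Using a direct limit
construction on the sequence of metric spaces `(Z^{1…k}_t, d^{Z^{1…k}}_t)`, we find a
correspondence `ℭ` between `𝒳¹, 𝒳², …` such that for any `i ∈ ℕ`
`d_𝔽^{ℭ,J}(𝒳^i, 𝒳^{i+1}) = d_𝔽^{ℭ^{i,i+1},J}(𝒳^i, 𝒳^{i+1}) < 2^{-i}`."* Lemma 5.15 glues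
`Z^{12}_t` and `Z^{23}_t` along the two isometric copies of `𝒳²_t` (§2.4, Lemma (combining
isometric embeddings)) when both middle embeddings exist, and takes a disjoint union otherwise.

This AUXILIARY file (no metric flows) carries out the two generic ingredients of that step:

* `MetricChainGlue.*` — **the metric gluing of a CHAIN** `Y 0 ⊇ X 0 ⊆ Y 1 ⊇ X 1 ⊆ Y 2 ⊇ …` of
  metric spaces `Y n` along "hubs" `X n` which CHANGE with `n` (unlike the fixed hub of
  `MetricWedgeFamily.lean`): given, for the "active" `n` (`A n`), a metric space `X n h` and
  isometric embeddings `f n h : X n h → Y n`, `g n h : X n h → Y (n + 1)`, the tower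
  `W₀ := Y 0`, `W_{n+1} := W_n ∪_{X n} Y (n + 1)` (Mathlib's `Metric.GlueSpace` along
  `emb_n ∘ f n` and `g n` if `A n` and `X n ≠ ∅`, the sum metric `Metric.metricSpaceSum`
  otherwise; `MetricChainGlue.step`, `stages`, `connect`), its direct limit
  `MetricChainGlue.Limit` (`Metric.InductiveLimit`) with isometric embeddings
  `MetricChainGlue.ι n : Y n → Limit` and the commutation
  `MetricChainGlue.ι_comm : ι n (f n h x) = ι (n + 1) (g n h x)`;
* `wassersteinW1_map_map_le_of_edist_le` / `wassersteinW1_map_map_eq_of_edist_eq` — **`d_{W₁}`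
  between push-forwards of probability measures on complete metric spaces `X₁, X₂` under
  isometric embeddings `φᵢ : Xᵢ → S` only depends on the distances `d(φ₁ x, φ₂ y)`**: if
  `ψᵢ : Xᵢ → T` satisfy `d(ψ₁ x, ψ₂ y) ≤ d(φ₁ x, φ₂ y)` then
  `d^T_{W₁}((ψ₁)_* ν₁, (ψ₂)_* ν₂) ≤ d^S_{W₁}((φ₁)_* ν₁, (φ₂)_* ν₂)` (couplings on `S × S` are pulled
  back to `X₁ × X₂`, `IsCoupling.comap_prodMap`, and pushed forward by `ψ₁ × ψ₂`), with
  equality for isometric `ψᵢ` realising the same distances — this is why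
  `d_𝔽^{ℭ,J} = d_𝔽^{ℭ^{i,i+1},J}` above (`S = Z^{i,i+1}_t`, `T = Z_t`, no completeness or
  separability of `S`, `T` needed).

## References

* R. H. Bamler, *Compactness theory of the space of super Ricci flows*, Invent. Math. 233 (2023),
  1121–1277 (arXiv:2008.09298), §2.4, Lemma (combining isometric embeddings); §5.2, Lemma 5.15
  (arXiv v1 Lemma 114); §5.4, proof of Thm. 5.19 (arXiv v1 Thm. 120). [Bamler2023]
-/

noncomputable section

open Set Function MeasureTheory
open scoped Topology ENNReal

namespace Literature.Geometry.Riemannian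

universe u

/-! ### The tower of glued spaces with a changing hub -/

namespace MetricChainGlue

variable {V : Type u} [MetricSpace V]

/-- One step of the chain tower: from a stage `W_n` carrying an isometric copy `emb` of `V = Y n`
to a stage `W_{n+1}` carrying an isometric copy of `V' = Y (n + 1)`, with an isometric inclusion
`W_n → W_{n+1}` under which, if the hub is active (`h : A`), the two copies `emb (f h x)` and
`emb' (g h x)` of each hub point agree.
[cite: Bamler2023, §5.2, Lemma 5.15 (arXiv v1 Lemma 114)] -/
structure Step (S : MetricWedge.Stage V) (V' : Type u) [MetricSpace V'] (A : Prop)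
    (X : A → Type u) (f : ∀ h, X h → V) (g : ∀ h, X h → V') : Type (u + 1) where
  /-- The next stage `W_{n+1}` (with its copy of `V'`). -/
  next : MetricWedge.Stage V'
  /-- The inclusion `W_n → W_{n+1}`. -/
  incl : S.carrier → next.carrier
  /-- `incl` is an isometric embedding. -/
  isometry_incl : Isometry incl
  /-- The two copies of the hub are identified. -/
  comm : ∀ (h : A) (x : X h), incl (S.emb (f h x)) = next.emb (g h x)

/-- The disjoint-union step `W_{n+1} := W_n ⊔ V'` (sum metric), used when nothing is glued (no
active hub, or an empty one). [cite: Bamler2023, §5.2, Lemma 5.15 (arXiv v1 Lemma 114)] -/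
def Step.sum (S : MetricWedge.Stage V) (V' : Type u) [MetricSpace V'] (A : Prop) (X : A → Type u)
    (f : ∀ h, X h → V) (g : ∀ h, X h → V') (hvac : ∀ h, IsEmpty (X h)) : Step S V' A X f g := by
  letI : MetricSpace (S.carrier ⊕ V') := Metric.metricSpaceSum
  exact
    { next :=
        { carrier := S.carrier ⊕ V'
          metric := Metric.metricSpaceSum
          emb := Sum.inr
          isometry_emb := Metric.isometry_inr }
      incl := Sum.inl
      isometry_incl := Metric.isometry_inl
      comm := fun h x ↦ ((hvac h).false x).elim }

/-- **The gluing step** `W_{n+1} := W_n ∪_{X} V'`: Mathlib's `Metric.GlueSpace` of `W_n` and `V'`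
along the isometric embeddings `emb ∘ f h : X h → W_n` and `g h : X h → V'` of the hub (Bamler
2023, §2.4, Lemma (combining isometric embeddings)) when the hub is active and nonempty; the
disjoint union otherwise. [cite: Bamler2023, §2.4, Lemma (combining isometric embeddings)] -/
def step (S : MetricWedge.Stage V) (V' : Type u) [MetricSpace V'] (A : Prop) (X : A → Type u)
    [∀ h, MetricSpace (X h)] (f : ∀ h, X h → V) (g : ∀ h, X h → V') (hf : ∀ h, Isometry (f h))
    (hg : ∀ h, Isometry (g h)) : Step S V' A X f g := by
  classical
  exact if h : A then
    if hX : Nonempty (X h) then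
      haveI : Nonempty (X h) := hX
      { next :=
          { carrier := Metric.GlueSpace (S.isometry_emb.comp (hf h)) (hg h)
            metric := inferInstance
            emb := Metric.toGlueR (S.isometry_emb.comp (hf h)) (hg h)
            isometry_emb := Metric.toGlueR_isometry _ _ }
        incl := Metric.toGlueL (S.isometry_emb.comp (hf h)) (hg h)
        isometry_incl := Metric.toGlueL_isometry _ _
        comm := fun _ x ↦ congrFun (Metric.toGlue_commute (S.isometry_emb.comp (hf h)) (hg h)) x }
    else Step.sum S V' A X f g fun _ ↦ ⟨fun x ↦ hX ⟨x⟩⟩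
  else Step.sum S V' A X f g fun h' ↦ (h h').elim

variable {Y : ℕ → Type u} [∀ n, MetricSpace (Y n)] {A : ℕ → Prop} {X : ∀ n, A n → Type u}
  [∀ n h, MetricSpace (X n h)] {f : ∀ n h, X n h → Y n} {g : ∀ n h, X n h → Y (n + 1)}
  (hf : ∀ n h, Isometry (f n h)) (hg : ∀ n h, Isometry (g n h))

/-- **The tower** `W₀ := Y 0`, `W_{n+1} := W_n ∪_{X n} Y (n + 1)` (iterative application of
Lemma 5.15 with the hub changing at each step), each stage carrying the isometric copy of the
last piece `Y n`. [cite: Bamler2023, §5.4, proof of Thm. 5.19 (arXiv v1 Thm. 120)] -/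
def stages : (n : ℕ) → MetricWedge.Stage (Y n)
  | 0 => MetricWedge.Stage.init (Y 0)
  | n + 1 => (step (stages n) (Y (n + 1)) (A n) (X n) (f n) (g n) (hf n) (hg n)).next

/-- The `n`-th step of the tower (from `W_n` to `W_{n+1}`).
[cite: Bamler2023, §5.4, proof of Thm. 5.19 (arXiv v1 Thm. 120)] -/
def steps (n : ℕ) : Step (stages hf hg n) (Y (n + 1)) (A n) (X n) (f n) (g n) :=
  step (stages hf hg n) (Y (n + 1)) (A n) (X n) (f n) (g n) (hf n) (hg n)

/-- `W_{n+1}` is the next stage of the `n`-th step.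
[cite: Bamler2023, §5.4, proof of Thm. 5.19 (arXiv v1 Thm. 120)] -/
theorem stages_succ (n : ℕ) : stages hf hg (n + 1) = (steps hf hg n).next := rfl

/-- The connecting isometric embeddings `W_n → W_{n+1}`.
[cite: Bamler2023, §5.4, proof of Thm. 5.19 (arXiv v1 Thm. 120)] -/
def connect (n : ℕ) : (stages hf hg n).carrier → (stages hf hg (n + 1)).carrier :=
  (steps hf hg n).incl

/-- The connecting maps are isometric embeddings.
[cite: Bamler2023, §5.4, proof of Thm. 5.19 (arXiv v1 Thm. 120)] -/
theorem isometry_connect (n : ℕ) : Isometry (connect hf hg n) :=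
  (steps hf hg n).isometry_incl

/-- **The direct limit** of the tower `W₀ → W₁ → …` (`Metric.InductiveLimit`), a metric space in
the universe of the pieces. [cite: Bamler2023, §5.4, proof of Thm. 5.19 (arXiv v1 Thm. 120)] -/
abbrev Limit : Type u :=
  Metric.InductiveLimit (isometry_connect hf hg)

/-- The isometric copy of the `n`-th piece `Y n` in the direct limit: `ιₙ := (W_n → lim) ∘ emb_n`.
[cite: Bamler2023, §5.4, proof of Thm. 5.19 (arXiv v1 Thm. 120)] -/
def ι (n : ℕ) : Y n → Limit hf hg :=
  Metric.toInductiveLimit (isometry_connect hf hg) n ∘ (stages hf hg n).emb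

/-- Each `ιₙ` is an isometric embedding. [cite: Bamler2023, §5.4, proof of Thm. 5.19 (arXiv v1 Thm. 120)] -/
theorem isometry_ι (n : ℕ) : Isometry (ι hf hg n) :=
  (Metric.toInductiveLimit_isometry _ n).comp (stages hf hg n).isometry_emb

/-- **The copies of an active hub agree in the limit**: `ιₙ (f n h x) = ι_{n+1} (g n h x)`
(the identities `ι^{12}_t ∘ φ^{12,2}_t = ι^{23}_t ∘ φ^{23,2}_t` of Lemma 5.15 survive the direct
limit). [cite: Bamler2023, §5.2, Lemma 5.15 (arXiv v1 Lemma 114, (5.13))] -/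
theorem ι_comm (n : ℕ) (h : A n) (x : X n h) : ι hf hg n (f n h x) = ι hf hg (n + 1) (g n h x) := by
  show Metric.toInductiveLimit (isometry_connect hf hg) n ((stages hf hg n).emb (f n h x)) =
    Metric.toInductiveLimit (isometry_connect hf hg) (n + 1) ((steps hf hg n).next.emb (g n h x))
  rw [← Metric.toInductiveLimit_commute (isometry_connect hf hg) n, comp_apply]
  exact congrArg _ ((steps hf hg n).comm h x)

end MetricChainGlue

/-! ### `d_{W₁}` of push-forwards under re-embeddings -/

section WassersteinMapMap

variable {X₁ X₂ S T : Type*} [MetricSpace X₁] [CompleteSpace X₁] [MeasurableSpace X₁]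
  [BorelSpace X₁] [MetricSpace X₂] [CompleteSpace X₂] [MeasurableSpace X₂] [BorelSpace X₂]
  [MetricSpace S] [MeasurableSpace S] [BorelSpace S] [MetricSpace T] [MeasurableSpace T]
  [BorelSpace T]

omit [BorelSpace T] in
/-- **`d_{W₁}` of push-forwards is monotone in the mutual distances of the embeddings**: for
isometric embeddings `φᵢ : Xᵢ → S` of complete metric spaces, measurable `ψᵢ : Xᵢ → T` with
`d(ψ₁ x, ψ₂ y) ≤ d(φ₁ x, φ₂ y)`, and probability measures `νᵢ` on `Xᵢ`,
`d^T_{W₁}((ψ₁)_* ν₁, (ψ₂)_* ν₂) ≤ d^S_{W₁}((φ₁)_* ν₁, (φ₂)_* ν₂)`: a coupling `q` on `S × S` pulls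
back to a coupling of `ν₁, ν₂` on `X₁ × X₂` (`IsCoupling.comap_prodMap`; `q` is carried by the
closed set `φ₁(X₁) × φ₂(X₂)`), whose push-forward by `ψ₁ × ψ₂` costs at most `∫ d dq`.
[cite: Bamler2023, §5.4, proof of Thm. 5.19 (arXiv v1 Thm. 120), `d^{ℭ,J}_𝔽 = d^{ℭ^{i,i+1},J}_𝔽`] -/
theorem wassersteinW1_map_map_le_of_edist_le {φ₁ : X₁ → S} {φ₂ : X₂ → S} {ψ₁ : X₁ → T}
    {ψ₂ : X₂ → T} (hφ₁ : Isometry φ₁) (hφ₂ : Isometry φ₂) (hψ₁ : Measurable ψ₁)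
    (hψ₂ : Measurable ψ₂) (hle : ∀ x y, edist (ψ₁ x) (ψ₂ y) ≤ edist (φ₁ x) (φ₂ y))
    (ν₁ : Measure X₁) (ν₂ : Measure X₂) [IsProbabilityMeasure ν₁] [IsProbabilityMeasure ν₂] :
    wassersteinW1 (ν₁.map ψ₁) (ν₂.map ψ₂) ≤ wassersteinW1 (ν₁.map φ₁) (ν₂.map φ₂) := by
  have hme₁ : MeasurableEmbedding φ₁ := hφ₁.isClosedEmbedding.measurableEmbedding
  have hme₂ : MeasurableEmbedding φ₂ := hφ₂.isClosedEmbedding.measurableEmbedding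
  refine le_iInf fun q ↦ ?_
  obtain ⟨q, hq⟩ := q
  obtain ⟨hc, hmap⟩ := hq.comap_prodMap hme₁ hme₂
  haveI := hc.1
  have hF : Measurable (Prod.map ψ₁ ψ₂) := hψ₁.prodMap hψ₂
  have hc' : IsCoupling (ν₁.map ψ₁) (ν₂.map ψ₂)
      ((q.comap (Prod.map φ₁ φ₂)).map (Prod.map ψ₁ ψ₂)) := by
    refine ⟨Measure.isProbabilityMeasure_map hF.aemeasurable, ?_, ?_⟩
    · rw [Measure.fst, Measure.map_map measurable_fst hF, ← hc.2.1, Measure.fst,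
        Measure.map_map hψ₁ measurable_fst]
      rfl
    · rw [Measure.snd, Measure.map_map measurable_snd hF, ← hc.2.2, Measure.snd,
        Measure.map_map hψ₂ measurable_snd]
      rfl
  refine (wassersteinW1_le_lintegral hc').trans ?_
  have hpull : ∫⁻ p, edist (φ₁ p.1) (φ₂ p.2) ∂(q.comap (Prod.map φ₁ φ₂)) =
      ∫⁻ z, edist z.1 z.2 ∂q := by
    have h := (hme₁.prodMap hme₂).lintegral_map (μ := q.comap (Prod.map φ₁ φ₂))
      (fun z : S × S ↦ edist z.1 z.2)
    rw [hmap] at h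
    rw [h]
    rfl
  calc ∫⁻ z, edist z.1 z.2 ∂((q.comap (Prod.map φ₁ φ₂)).map (Prod.map ψ₁ ψ₂))
      ≤ ∫⁻ p, edist (ψ₁ p.1) (ψ₂ p.2) ∂(q.comap (Prod.map φ₁ φ₂)) := lintegral_map_le _ _
    _ ≤ ∫⁻ p, edist (φ₁ p.1) (φ₂ p.2) ∂(q.comap (Prod.map φ₁ φ₂)) :=
        lintegral_mono fun p ↦ hle p.1 p.2
    _ = ∫⁻ z, edist z.1 z.2 ∂q := hpull

/-- **`d_{W₁}` of push-forwards only depends on the mutual distances of the embeddings**: for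
isometric embeddings `φᵢ : Xᵢ → S`, `ψᵢ : Xᵢ → T` of complete metric spaces into two metric
spaces with `d(ψ₁ x, ψ₂ y) = d(φ₁ x, φ₂ y)` for all `x, y`, and probability measures `νᵢ`,
`d^T_{W₁}((ψ₁)_* ν₁, (ψ₂)_* ν₂) = d^S_{W₁}((φ₁)_* ν₁, (φ₂)_* ν₂)` — in particular `d_{W₁}` of
push-forwards is unchanged by composing both embeddings with one isometric embedding `S → T`
(the reason why `d^{ℭ,J}_𝔽 = d^{ℭ^{i,i+1},J}_𝔽` for the combined correspondence).
[cite: Bamler2023, §5.4, proof of Thm. 5.19 (arXiv v1 Thm. 120), `d^{ℭ,J}_𝔽 = d^{ℭ^{i,i+1},J}_𝔽`] -/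
theorem wassersteinW1_map_map_eq_of_edist_eq {φ₁ : X₁ → S} {φ₂ : X₂ → S} {ψ₁ : X₁ → T}
    {ψ₂ : X₂ → T} (hφ₁ : Isometry φ₁) (hφ₂ : Isometry φ₂) (hψ₁ : Isometry ψ₁) (hψ₂ : Isometry ψ₂)
    (heq : ∀ x y, edist (ψ₁ x) (ψ₂ y) = edist (φ₁ x) (φ₂ y)) (ν₁ : Measure X₁) (ν₂ : Measure X₂)
    [IsProbabilityMeasure ν₁] [IsProbabilityMeasure ν₂] :
    wassersteinW1 (ν₁.map ψ₁) (ν₂.map ψ₂) = wassersteinW1 (ν₁.map φ₁) (ν₂.map φ₂) :=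
  le_antisymm
    (wassersteinW1_map_map_le_of_edist_le hφ₁ hφ₂ hψ₁.continuous.measurable
      hψ₂.continuous.measurable (fun x y ↦ (heq x y).le) ν₁ ν₂)
    (wassersteinW1_map_map_le_of_edist_le hψ₁ hψ₂ hφ₁.continuous.measurable
      hφ₂.continuous.measurable (fun x y ↦ (heq x y).ge) ν₁ ν₂)

end WassersteinMapMap

end Literature.Geometry.Riemannian

end
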